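import Literature.AlgebraicGeometry.AbelianVarieties.MarkmanKernelTransformDescent
import Literature.AlgebraicGeometry.Modules.PullbackCoh
import HarnessLib

/-!
# The descended input `Ñ₀ = ε^*𝒩₀ ⊗ (ε ≫ pr₁₂)^*F₀` is coherent, and `E = R(pr_Y)_*(Ñ₀[0])` lives in degrees `≥ 0`
# (bookkeeping for the vector-bundle model of Markman's descended transform; Hartshorne II 5.8, III §8)

Layer `Literature/AlgebraicGeometry/AbelianVarieties`; sequel to `MarkmanKernelTransformDescent` ((K3)+(K5)). Two 0-fact inputs of
the (m) MODEL step «`E := markmanDescendedTransform … F₀` has bounded coherent cohomology» (the other two being Grothendieck's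
coherence of higher direct images and an upper amplitude bound):

* §0 generic: `coh_tensorObj_of_isFiniteLocallyFree` (`L ⊗ M` coherent for `L` finite locally free, `M` coherent, `X` locally
  noetherian: `L ⊗ M ≅ 𝓗om(L^∨, M)` + `Modules/SheafHomCoh`), and **`isGE_zero_derivedPushforwardPlus_single`**: for ANY morphism
  `f` and ANY module `N`, `Rf_*(N[0])` is cohomologically `≥ 0` (injective resolution in degrees `≥ 0`, `Modules/DerivedPushforward`);
* §1 **`coh_markmanDescendedInput (hF₀ : Coh F₀) : Coh Ñ₀`** (pull-backs of coherent modules between locally noetherian schemes are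
  coherent, `Modules/PullbackCoh`; `ε^*𝒩₀` is a line bundle) and **`isGE_zero_markmanDescendedTransform`**.

Everything PROVED; 0 named facts; no instances. Typed for the cell `pub-hodge-ring2` (road (m-a′) of record); a research route
conditional on HC_CM, not a corollary — nothing in this file refers to it.

## References

* R. Hartshorne, *Algebraic Geometry*, GTM 52 (1977), II Prop. 5.8, II Ex. 5.1 (b), III §8 p. 250. [Hartshorne1977]
* E. Markman, arXiv:2502.03415 (2025), §9.3 Remark 9.3.7 (p. 73). [Markman2025SecantWeil]
* The Stacks Project, Tag 01BQ. [StacksProject]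
-/

noncomputable section

-- `TopCat.Presheaf`/`Scheme.Modules` are not reducible (as in Mathlib's `AlgebraicGeometry/Modules/Sheaf.lean`).
set_option backward.isDefEq.respectTransparency false

open CategoryTheory CategoryTheory.Limits AlgebraicGeometry MonoidalCategory CartesianMonoidalCategory
open AlgebraicGeometry.Scheme.Modules

universe v₄ v₅ w w' u

/-! ### §0 Generic: coherence of `L ⊗ M`; `Rf_*(N[0])` is `≥ 0` -/

namespace Literature.AlgebraicGeometry.Modules

open Literature.AlgebraicGeometry.Motives Literature.AlgebraicGeometry.Morphisms

/-- **`L ⊗ M` is coherent for `L` finite locally free and `M` coherent** on a locally noetherian scheme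
(`L ⊗ M ≅ 𝓗om(L^∨, M)`, `𝓗om` of coherent modules is coherent). [cite: Hartshorne1977, II Ex. 5.1 (b) and Prop. 5.7] -/
theorem coh_tensorObj_of_isFiniteLocallyFree {X : Scheme.{0}} [IsLocallyNoetherian X] {L M : X.Modules}
    (hL : IsFiniteLocallyFree L) (hM : Coh M) : Coh (tensorObj L M) := by
  have hLd := coh_of_isVectorBundle (isFiniteLocallyFree_dual hL).isVectorBundle
  have h := coh_sheafHom hLd hM
  exact ⟨IsAffineLocalizing.of_iso (tensorSheafHomDualIso L M hL).symm h.loc,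
    IsAffineFiniteType.of_iso (tensorSheafHomDualIso L M hL).symm h.ft⟩

variable {X Y : Scheme.{u}} (f : X ⟶ Y) [HasDerivedCategory.{w} X.Modules] [HasDerivedCategory.{w'} Y.Modules]

/-- **`Rf_*(N[0])` is cohomologically `≥ 0`** for every morphism `f` and every `𝒪_X`-module `N`: an injective resolution of
`N[0]` in degrees `≥ 0` computes it (`derivedPushforwardPlusObjIso`). [cite: Hartshorne1977, III §8 p. 250 (Rⁱf_* = 0 for i < 0)] -/
theorem isGE_zero_derivedPushforwardPlus_single (N : X.Modules) :
    ((derivedPushforwardPlus f).obj ((DerivedCategory.Plus.singleFunctor X.Modules 0).obj N)).IsGE 0 := by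
  haveI := isStrictlyGE_singlePlus N
  obtain ⟨I, hI0, hI, ι, hι⟩ := exists_injective_resolution (singlePlus N) 0
  have e := (derivedPushforwardPlus f).mapIso (singleFunctorPlusObjIsoQ N) ≪≫ derivedPushforwardPlusObjIso f ι
  haveI : CochainComplex.IsStrictlyGE ((Scheme.Modules.pushforward f).mapCochainComplexPlus.obj I).obj 0 :=
    inferInstanceAs (CochainComplex.IsStrictlyGE
      (((Scheme.Modules.pushforward f).mapHomologicalComplex (ComplexShape.up ℤ)).obj I.obj) 0)
  haveI : (DerivedCategory.Plus.Q.obj ((Scheme.Modules.pushforward f).mapCochainComplexPlus.obj I)).IsGE 0 := by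
    rw [← DerivedCategory.Plus.isGE_ι_obj_iff]
    exact DerivedCategory.TStructure.t.isGE_of_iso (ιQObjIso _).symm 0
  exact DerivedCategory.Plus.TStructure.t.isGE_of_iso e.symm 0

end Literature.AlgebraicGeometry.Modules

/-! ### §1 `Ñ₀` is coherent; `E` is `≥ 0` -/

namespace Literature.AlgebraicGeometry.AbelianVarieties

open Literature.AlgebraicGeometry.Motives Literature.AlgebraicGeometry.Modules Literature.AlgebraicGeometry.Markman2025
open Literature.AlgebraicGeometry.Morphisms

variable (A : AbelianVariety ℂ) {Θ : CartierDivisor A.X.left} (hΘ : Θ.IsAmple) (hK : A.KTheta Θ = ⊥)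
  {n : ℕ} (hn : n ≠ 0) (G₁ G₂ : Subgroup (A.Points ℂ)) (hG₁ : G₁ ≤ A.torsionPoints ℂ n) (hG₂ : G₂ ≤ A.torsionPoints ℂ n)

/-- **`Ñ₀ = ε^*𝒩₀ ⊗ (ε ≫ pr₁₂)^*F₀` is coherent for `F₀` coherent** (line bundle ⊗ pull-back of a coherent module between
locally noetherian schemes). [cite: Hartshorne1977, II Prop. 5.8 and Ex. 5.1 (b)] [cite: StacksProject, Tag 01BQ] -/
theorem coh_markmanDescendedInput {j : ℕ} (hj : 2 * j + 1 = n) (s m₁ m₂ : ℕ)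
    (F₀ : ((A.torsionQuot hn G₁ hG₁).X ⊗ (A.torsionQuot hn G₂ hG₂).X).left.Modules) (hF₀ : Coh F₀) :
    Coh (markmanDescendedInput A hΘ hK hn G₁ G₂ hG₁ hG₂ hj s m₁ m₂ F₀) := by
  haveI : IsLocallyNoetherian ((secantQuotient A hΘ G₁ G₂ hn hG₁ hG₂).X ⊗ A.X).left :=
    inferInstanceAs (IsLocallyNoetherian ((secantQuotient A hΘ G₁ G₂ hn hG₁ hG₂).prod A).X.left)
  haveI : IsLocallyNoetherian ((A.torsionQuot hn G₁ hG₁).X ⊗ (A.torsionQuot hn G₂ hG₂).X).left :=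
    inferInstanceAs (IsLocallyNoetherian ((A.torsionQuot hn G₁ hG₁).prod (A.torsionQuot hn G₂ hG₂)).X.left)
  exact coh_tensorObj_of_isFiniteLocallyFree
    ((isFiniteLocallyFree_markmanDescendedKernel A hΘ hK hn G₁ G₂ hG₁ hG₂ s m₁ m₂).pullback _) (coh_pullback _ F₀ hF₀)

variable [HasDerivedCategory.{v₄} ((secantQuotient A hΘ G₁ G₂ hn hG₁ hG₂).X ⊗ A.X).left.Modules]
  [HasDerivedCategory.{v₅} (secantQuotient A hΘ G₁ G₂ hn hG₁ hG₂).X.left.Modules]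

/-- **`E = R(pr_Y)_*(Ñ₀[0])` is cohomologically `≥ 0`.** [cite: Hartshorne1977, III §8 p. 250] [cite: Markman2025SecantWeil, §9.3 Remark 9.3.7 (p. 73)] -/
theorem isGE_zero_markmanDescendedTransform {j : ℕ} (hj : 2 * j + 1 = n) (s m₁ m₂ : ℕ)
    (F₀ : ((A.torsionQuot hn G₁ hG₁).X ⊗ (A.torsionQuot hn G₂ hG₂).X).left.Modules) :
    (markmanDescendedTransform A hΘ hK hn G₁ G₂ hG₁ hG₂ hj s m₁ m₂ F₀).IsGE 0 :=
  isGE_zero_derivedPushforwardPlus_single _ _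

end Literature.AlgebraicGeometry.AbelianVarieties

end
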